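import Mathlib
import Summits.Ventures.HodgeRepro0.P1LatticeIndexOneBridge1
import Summits.Ventures.HodgeRepro0.P1LatticeIndexOne180L
import Summits.Ventures.HodgeRepro0.P1LatticeIndexOne180M
import Summits.Ventures.HodgeRepro0.P1LatticeIndexOne180N

/-!
# P1LatticeIndexOne180Bridge4 — THEOREM A′ of the D14 object (proofs/P1-FermatLatticeClosure180-v1.1.md l.4: D13's Theorem A
continued to 121 ≤ M ≤ 180) at its index-1 degrees: H_M = L_M AS AN EQUALITY — THE BRIDGES FOR THE NAMESPACES 180L, 180M, 180N
of p1 (g30)'s artefact lean/P1LatticeIndexOne180A–N.lean (pub-hodge-repro0, p1 (g30), 2026-08-30), on the general lemmas of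
lean/P1LatticeIndexTwoExactHodge.lean (the weight identity `conMat_mulVec_oddVec`, `units_ok_of_lists`), Core3's
`mem_span_of_mulVec` and the pull-back lemma `isHodge_pullback` of lean/P1LatticeIndexOneBridge1.lean (p1 (g29)) — the bridge
text of p1 (g29)'s study 2 (proofs/p1-scripts/lattice-index-one-eq-lean/bridge_template.lean), the namespace substituted.

Supporting artefact in the sense of ROUTE.md R-5 (finite combinatorics / exact arithmetic only; never the discharge of a
Hodge-theoretic step; record-only).  THE OBJECTS, as p1 (g30)'s artefact lean/P1LatticeIndexOne180A–N.lean states them (fourteen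
self-contained files, each with its own copies of the definitions in its own namespace — the text of p1 (g27)'s
lean/P1LatticeIndexOneA–I.lean): a `Block` = (a level m′ ∣ M, a unit translate t, a kind, a base multiset of level m′, the σ
parameters p, i); `Block.ms M` = the base translated by t and pulled back by M/m′ — the multiset {(M/m′)·((t·x) mod m′) mod M};
`Block.ok M` = the page's legitimacy (Lemma 1 (b) of proofs/P1-FermatLatticeClosure-v1.2.md, used unchanged by the D14 object
proofs/P1-FermatLatticeClosure180-v1.1.md: m′ ∣ M, 3 ≤ m′, t a unit mod M, the base a Hodge multiset of level m′ with entries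
below m′, and a Hodge 4-multiset / a split Hodge 6-multiset / Aoki's σ_{p,i} by the kind); `oddVec` on lists; `conMat`;
per degree `units_complete_M`, `blocks_ok_M` (the listed blocks are legitimate) and `generated_M` — every s with B_M·s = 0
is an integer combination of the listed blocks' odd vectors (or s = 0 at the eleven primes 127, 131, 137, 139, 149, 151, 157, 163, 167, 173, 179,
where H_M = 0): H_M ⊆ L_M.
THIS ARTEFACT adds the other containment, in general, and states the equality: H_M := ker (mulVecLin B_M) and
L_M := the ℤ-span of the odd vectors of ALL legitimate blocks (`X180_L M n`, the page's BLK(M) as a PREDICATE on `Block`,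
not the listed set) satisfy H_M = L_M at every one of the thirty-one index-1 degrees of 121 ≤ M ≤ 180 — THEOREM A′'s
«[H_M : L_M] = 1» on the coordinates a < M/2 as an EQUALITY OF LATTICES (the coordinate M/2 of an even M taken modulo
2e_{M/2}, the page's l.7 bookkeeping, as in every p1 artefact) — exactly the form of p1 (g29)'s lean/P1LatticeIndexOneEqA–B.lean
at the 88 index-1 degrees 3 ≤ M ≤ 120.

THE BRIDGE, per namespace 180X (one text, the letter substituted): `X180_isHodge_to` — their Bool `isHodge` implies the g28
predicate `IsHodge` (entries below the level); `X180_ok_isHodge` — a legitimate block's multiset at M is a Hodge multiset of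
level M (the pull-back lemma); `X180_L M n` — L_M as a submodule; `X180_mem_ker_of_ok` — every legitimate block's odd vector
(their `oddVec` on the list = the g28 `oddVec` on the coerced multiset, `Multiset.coe_count`) satisfies every weight
constraint (their `conMat` IS the g28 `conMat`, definitionally); `X180_span_le_ker` — L_M ≤ H_M; `X180_ker_le_span` /
`X180_ker_le_span_of_zero` — H_M ≤ L_M from `generated_M` (every row of `genMat M blocks g n` is the odd vector of a listed,
hence legitimate, block; or s = 0).  The per-degree equalities are in lean/P1LatticeIndexOne180Eq.lean.
NOT formalised: claim(·) for the blocks (Shioda 1981 Thm 4.3 / Lefschetz (1,1), Aoki 1987 Thm 2-1 / Thm 1-4); anything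
Hodge-theoretic.
Nothing here asserts anything about whether the statement of README §1 has been proved elsewhere.
-/

namespace HodgeRepro0.P1.P1LatticeIndexTwoExact
open Matrix

/-! ## The bridge for the namespace `P1LatticeIndexOne180L` (the degree file 180L) -/

/-- (L180) their Bool Hodge test implies the multiset predicate `IsHodge` (with the entries below the level) -/
theorem L180_isHodge_to (mm : ℕ) (x : List ℕ) (h : P1LatticeIndexOne180L.isHodge mm x = true) (hlt : ∀ a ∈ x, a < mm) :
    IsHodge mm (x : Multiset ℕ) := by
  simp only [P1LatticeIndexOne180L.isHodge, Bool.and_eq_true, beq_iff_eq, List.all_eq_true, bne_iff_ne, ne_eq,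
    List.mem_filter, List.mem_range, decide_eq_true_eq] at h
  obtain ⟨⟨h1, h2⟩, h3⟩ := h
  refine ⟨by rw [Multiset.coe_card, Nat.even_iff]; exact h1, ?_, fun u hu hg => by rw [wt_coe]; exact h3 u ⟨hu, hg⟩⟩
  intro a ha
  rw [Multiset.mem_coe] at ha
  have ha1 := h2 a ha
  refine ⟨?_, hlt a ha⟩
  rcases Nat.eq_zero_or_pos a with h0 | h0
  · exact absurd (by rw [h0, Nat.zero_mod]) ha1
  · exact h0

/-- (L180) a legitimate block's multiset at M is a Hodge multiset of level M (the pull-back lemma) -/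
theorem L180_ok_isHodge (M : ℕ) (hM : 0 < M) (b : P1LatticeIndexOne180L.Block) (h : b.ok M = true) :
    IsHodge M ((b.ms M : List ℕ) : Multiset ℕ) := by
  unfold P1LatticeIndexOne180L.Block.ok at h
  simp only [Bool.and_eq_true, beq_iff_eq, decide_eq_true_eq, List.all_eq_true] at h
  obtain ⟨⟨⟨⟨⟨hdiv, h3⟩, ht⟩, hlt⟩, hH⟩, _⟩ := h
  unfold P1LatticeIndexOne180L.Block.ms
  exact isHodge_pullback M b.level b.t b.base hM hdiv (by omega) ht (L180_isHodge_to b.level b.base hH hlt)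

/-- (L180) L_M as a submodule: the ℤ-span of the odd vectors of ALL legitimate blocks of the degree M (the page's BLK(M) as
a PREDICATE — every `Block` passing `Block.ok M`, not the listed ones) on the coordinates a < M/2 -/
abbrev L180_L (M n : ℕ) : Submodule ℤ (Fin n → ℤ) :=
  Submodule.span ℤ ((fun ms : List ℕ => (fun a : Fin n => P1LatticeIndexOne180L.oddVec M ms a)) ''
    {ms | ∃ b : P1LatticeIndexOne180L.Block, b.ok M = true ∧ ms = b.ms M})

/-- (L180) every legitimate block's odd vector satisfies every weight constraint -/
theorem L180_mem_ker_of_ok {n u : ℕ} (M : ℕ) (hM : 0 < M) (hn : n = (M - 1) / 2) (unitsF : Fin u → ℕ)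
    (hU : ∀ i, unitsF i < M ∧ Nat.gcd (unitsF i) M = 1) (b : P1LatticeIndexOne180L.Block) (h : b.ok M = true) :
    P1LatticeIndexOne180L.conMat (n := n) M unitsF *ᵥ (fun a => P1LatticeIndexOne180L.oddVec M (b.ms M) a) = 0 := by
  have e : (fun a : Fin n => P1LatticeIndexOne180L.oddVec M (b.ms M) a) =
      oddVec (n := n) M ((b.ms M : List ℕ) : Multiset ℕ) := by
    funext a
    simp [P1LatticeIndexOne180L.oddVec, oddVec, Multiset.coe_count]
  rw [e]
  exact conMat_mulVec_oddVec M hn unitsF hU _ (L180_ok_isHodge M hM b h)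

/-- (L180) L_M ≤ H_M -/
theorem L180_span_le_ker {n u : ℕ} (M : ℕ) (hM : 0 < M) (hn : n = (M - 1) / 2) (unitsF : Fin u → ℕ)
    (hU : ∀ i, unitsF i < M ∧ Nat.gcd (unitsF i) M = 1) :
    L180_L M n ≤ LinearMap.ker (Matrix.mulVecLin (P1LatticeIndexOne180L.conMat (n := n) M unitsF)) := by
  rw [Submodule.span_le]
  rintro _ ⟨ms, ⟨b, hb, rfl⟩, rfl⟩
  rw [SetLike.mem_coe, LinearMap.mem_ker, Matrix.mulVecLin_apply]
  exact L180_mem_ker_of_ok M hM hn unitsF hU b hb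

/-- (L180) H_M ≤ L_M from the g27 certificate: every s ∈ H_M is an integer combination of the listed blocks' odd vectors, and
every listed block is legitimate -/
theorem L180_ker_le_span {n u g : ℕ} (M : ℕ) (B : Matrix (Fin u) (Fin n) ℤ) (blocks : List P1LatticeIndexOne180L.Block)
    (hlen : blocks.length = g) (hok : blocks.all (P1LatticeIndexOne180L.Block.ok M) = true)
    (hgen : ∀ s : Fin n → ℤ, B *ᵥ s = 0 → ∃ c : Fin g → ℤ, s = (P1LatticeIndexOne180L.genMat M blocks g n).transpose *ᵥ c) :
    LinearMap.ker (Matrix.mulVecLin B) ≤ L180_L M n := by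
  intro s hs
  rw [LinearMap.mem_ker, Matrix.mulVecLin_apply] at hs
  obtain ⟨c, hc⟩ := hgen s hs
  rw [hc]
  refine mem_span_of_mulVec _ _ (fun j => ?_) c
  have hj : j.val < blocks.length := by
    rw [hlen]
    exact j.isLt
  have hmem : blocks.getD j.val ⟨3, 1, 0, [], 0, 0⟩ ∈ blocks := by
    rw [List.getD_eq_getElem _ _ hj]
    exact List.getElem_mem hj
  exact ⟨(blocks.getD j.val ⟨3, 1, 0, [], 0, 0⟩).ms M, ⟨_, (List.all_eq_true.mp hok) _ hmem, rfl⟩, rfl⟩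

/-- (L180) H_M ≤ L_M at a degree where H_M = 0 -/
theorem L180_ker_le_span_of_zero {n u : ℕ} (M : ℕ) (B : Matrix (Fin u) (Fin n) ℤ)
    (hgen : ∀ s : Fin n → ℤ, B *ᵥ s = 0 → s = 0) : LinearMap.ker (Matrix.mulVecLin B) ≤ L180_L M n := by
  intro s hs
  rw [LinearMap.mem_ker, Matrix.mulVecLin_apply] at hs
  rw [hgen s hs]
  exact Submodule.zero_mem _

/-! ## The bridge for the namespace `P1LatticeIndexOne180M` (the degree file 180M) -/

/-- (M180) their Bool Hodge test implies the multiset predicate `IsHodge` (with the entries below the level) -/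
theorem M180_isHodge_to (mm : ℕ) (x : List ℕ) (h : P1LatticeIndexOne180M.isHodge mm x = true) (hlt : ∀ a ∈ x, a < mm) :
    IsHodge mm (x : Multiset ℕ) := by
  simp only [P1LatticeIndexOne180M.isHodge, Bool.and_eq_true, beq_iff_eq, List.all_eq_true, bne_iff_ne, ne_eq,
    List.mem_filter, List.mem_range, decide_eq_true_eq] at h
  obtain ⟨⟨h1, h2⟩, h3⟩ := h
  refine ⟨by rw [Multiset.coe_card, Nat.even_iff]; exact h1, ?_, fun u hu hg => by rw [wt_coe]; exact h3 u ⟨hu, hg⟩⟩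
  intro a ha
  rw [Multiset.mem_coe] at ha
  have ha1 := h2 a ha
  refine ⟨?_, hlt a ha⟩
  rcases Nat.eq_zero_or_pos a with h0 | h0
  · exact absurd (by rw [h0, Nat.zero_mod]) ha1
  · exact h0

/-- (M180) a legitimate block's multiset at M is a Hodge multiset of level M (the pull-back lemma) -/
theorem M180_ok_isHodge (M : ℕ) (hM : 0 < M) (b : P1LatticeIndexOne180M.Block) (h : b.ok M = true) :
    IsHodge M ((b.ms M : List ℕ) : Multiset ℕ) := by
  unfold P1LatticeIndexOne180M.Block.ok at h
  simp only [Bool.and_eq_true, beq_iff_eq, decide_eq_true_eq, List.all_eq_true] at h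
  obtain ⟨⟨⟨⟨⟨hdiv, h3⟩, ht⟩, hlt⟩, hH⟩, _⟩ := h
  unfold P1LatticeIndexOne180M.Block.ms
  exact isHodge_pullback M b.level b.t b.base hM hdiv (by omega) ht (M180_isHodge_to b.level b.base hH hlt)

/-- (M180) L_M as a submodule: the ℤ-span of the odd vectors of ALL legitimate blocks of the degree M (the page's BLK(M) as
a PREDICATE — every `Block` passing `Block.ok M`, not the listed ones) on the coordinates a < M/2 -/
abbrev M180_L (M n : ℕ) : Submodule ℤ (Fin n → ℤ) :=
  Submodule.span ℤ ((fun ms : List ℕ => (fun a : Fin n => P1LatticeIndexOne180M.oddVec M ms a)) ''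
    {ms | ∃ b : P1LatticeIndexOne180M.Block, b.ok M = true ∧ ms = b.ms M})

/-- (M180) every legitimate block's odd vector satisfies every weight constraint -/
theorem M180_mem_ker_of_ok {n u : ℕ} (M : ℕ) (hM : 0 < M) (hn : n = (M - 1) / 2) (unitsF : Fin u → ℕ)
    (hU : ∀ i, unitsF i < M ∧ Nat.gcd (unitsF i) M = 1) (b : P1LatticeIndexOne180M.Block) (h : b.ok M = true) :
    P1LatticeIndexOne180M.conMat (n := n) M unitsF *ᵥ (fun a => P1LatticeIndexOne180M.oddVec M (b.ms M) a) = 0 := by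
  have e : (fun a : Fin n => P1LatticeIndexOne180M.oddVec M (b.ms M) a) =
      oddVec (n := n) M ((b.ms M : List ℕ) : Multiset ℕ) := by
    funext a
    simp [P1LatticeIndexOne180M.oddVec, oddVec, Multiset.coe_count]
  rw [e]
  exact conMat_mulVec_oddVec M hn unitsF hU _ (M180_ok_isHodge M hM b h)

/-- (M180) L_M ≤ H_M -/
theorem M180_span_le_ker {n u : ℕ} (M : ℕ) (hM : 0 < M) (hn : n = (M - 1) / 2) (unitsF : Fin u → ℕ)
    (hU : ∀ i, unitsF i < M ∧ Nat.gcd (unitsF i) M = 1) :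
    M180_L M n ≤ LinearMap.ker (Matrix.mulVecLin (P1LatticeIndexOne180M.conMat (n := n) M unitsF)) := by
  rw [Submodule.span_le]
  rintro _ ⟨ms, ⟨b, hb, rfl⟩, rfl⟩
  rw [SetLike.mem_coe, LinearMap.mem_ker, Matrix.mulVecLin_apply]
  exact M180_mem_ker_of_ok M hM hn unitsF hU b hb

/-- (M180) H_M ≤ L_M from the g27 certificate: every s ∈ H_M is an integer combination of the listed blocks' odd vectors, and
every listed block is legitimate -/
theorem M180_ker_le_span {n u g : ℕ} (M : ℕ) (B : Matrix (Fin u) (Fin n) ℤ) (blocks : List P1LatticeIndexOne180M.Block)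
    (hlen : blocks.length = g) (hok : blocks.all (P1LatticeIndexOne180M.Block.ok M) = true)
    (hgen : ∀ s : Fin n → ℤ, B *ᵥ s = 0 → ∃ c : Fin g → ℤ, s = (P1LatticeIndexOne180M.genMat M blocks g n).transpose *ᵥ c) :
    LinearMap.ker (Matrix.mulVecLin B) ≤ M180_L M n := by
  intro s hs
  rw [LinearMap.mem_ker, Matrix.mulVecLin_apply] at hs
  obtain ⟨c, hc⟩ := hgen s hs
  rw [hc]
  refine mem_span_of_mulVec _ _ (fun j => ?_) c
  have hj : j.val < blocks.length := by
    rw [hlen]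
    exact j.isLt
  have hmem : blocks.getD j.val ⟨3, 1, 0, [], 0, 0⟩ ∈ blocks := by
    rw [List.getD_eq_getElem _ _ hj]
    exact List.getElem_mem hj
  exact ⟨(blocks.getD j.val ⟨3, 1, 0, [], 0, 0⟩).ms M, ⟨_, (List.all_eq_true.mp hok) _ hmem, rfl⟩, rfl⟩

/-- (M180) H_M ≤ L_M at a degree where H_M = 0 -/
theorem M180_ker_le_span_of_zero {n u : ℕ} (M : ℕ) (B : Matrix (Fin u) (Fin n) ℤ)
    (hgen : ∀ s : Fin n → ℤ, B *ᵥ s = 0 → s = 0) : LinearMap.ker (Matrix.mulVecLin B) ≤ M180_L M n := by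
  intro s hs
  rw [LinearMap.mem_ker, Matrix.mulVecLin_apply] at hs
  rw [hgen s hs]
  exact Submodule.zero_mem _

/-! ## The bridge for the namespace `P1LatticeIndexOne180N` (the degree file 180N) -/

/-- (N180) their Bool Hodge test implies the multiset predicate `IsHodge` (with the entries below the level) -/
theorem N180_isHodge_to (mm : ℕ) (x : List ℕ) (h : P1LatticeIndexOne180N.isHodge mm x = true) (hlt : ∀ a ∈ x, a < mm) :
    IsHodge mm (x : Multiset ℕ) := by
  simp only [P1LatticeIndexOne180N.isHodge, Bool.and_eq_true, beq_iff_eq, List.all_eq_true, bne_iff_ne, ne_eq,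
    List.mem_filter, List.mem_range, decide_eq_true_eq] at h
  obtain ⟨⟨h1, h2⟩, h3⟩ := h
  refine ⟨by rw [Multiset.coe_card, Nat.even_iff]; exact h1, ?_, fun u hu hg => by rw [wt_coe]; exact h3 u ⟨hu, hg⟩⟩
  intro a ha
  rw [Multiset.mem_coe] at ha
  have ha1 := h2 a ha
  refine ⟨?_, hlt a ha⟩
  rcases Nat.eq_zero_or_pos a with h0 | h0
  · exact absurd (by rw [h0, Nat.zero_mod]) ha1
  · exact h0

/-- (N180) a legitimate block's multiset at M is a Hodge multiset of level M (the pull-back lemma) -/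
theorem N180_ok_isHodge (M : ℕ) (hM : 0 < M) (b : P1LatticeIndexOne180N.Block) (h : b.ok M = true) :
    IsHodge M ((b.ms M : List ℕ) : Multiset ℕ) := by
  unfold P1LatticeIndexOne180N.Block.ok at h
  simp only [Bool.and_eq_true, beq_iff_eq, decide_eq_true_eq, List.all_eq_true] at h
  obtain ⟨⟨⟨⟨⟨hdiv, h3⟩, ht⟩, hlt⟩, hH⟩, _⟩ := h
  unfold P1LatticeIndexOne180N.Block.ms
  exact isHodge_pullback M b.level b.t b.base hM hdiv (by omega) ht (N180_isHodge_to b.level b.base hH hlt)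

/-- (N180) L_M as a submodule: the ℤ-span of the odd vectors of ALL legitimate blocks of the degree M (the page's BLK(M) as
a PREDICATE — every `Block` passing `Block.ok M`, not the listed ones) on the coordinates a < M/2 -/
abbrev N180_L (M n : ℕ) : Submodule ℤ (Fin n → ℤ) :=
  Submodule.span ℤ ((fun ms : List ℕ => (fun a : Fin n => P1LatticeIndexOne180N.oddVec M ms a)) ''
    {ms | ∃ b : P1LatticeIndexOne180N.Block, b.ok M = true ∧ ms = b.ms M})

/-- (N180) every legitimate block's odd vector satisfies every weight constraint -/
theorem N180_mem_ker_of_ok {n u : ℕ} (M : ℕ) (hM : 0 < M) (hn : n = (M - 1) / 2) (unitsF : Fin u → ℕ)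
    (hU : ∀ i, unitsF i < M ∧ Nat.gcd (unitsF i) M = 1) (b : P1LatticeIndexOne180N.Block) (h : b.ok M = true) :
    P1LatticeIndexOne180N.conMat (n := n) M unitsF *ᵥ (fun a => P1LatticeIndexOne180N.oddVec M (b.ms M) a) = 0 := by
  have e : (fun a : Fin n => P1LatticeIndexOne180N.oddVec M (b.ms M) a) =
      oddVec (n := n) M ((b.ms M : List ℕ) : Multiset ℕ) := by
    funext a
    simp [P1LatticeIndexOne180N.oddVec, oddVec, Multiset.coe_count]
  rw [e]
  exact conMat_mulVec_oddVec M hn unitsF hU _ (N180_ok_isHodge M hM b h)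

/-- (N180) L_M ≤ H_M -/
theorem N180_span_le_ker {n u : ℕ} (M : ℕ) (hM : 0 < M) (hn : n = (M - 1) / 2) (unitsF : Fin u → ℕ)
    (hU : ∀ i, unitsF i < M ∧ Nat.gcd (unitsF i) M = 1) :
    N180_L M n ≤ LinearMap.ker (Matrix.mulVecLin (P1LatticeIndexOne180N.conMat (n := n) M unitsF)) := by
  rw [Submodule.span_le]
  rintro _ ⟨ms, ⟨b, hb, rfl⟩, rfl⟩
  rw [SetLike.mem_coe, LinearMap.mem_ker, Matrix.mulVecLin_apply]
  exact N180_mem_ker_of_ok M hM hn unitsF hU b hb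

/-- (N180) H_M ≤ L_M from the g27 certificate: every s ∈ H_M is an integer combination of the listed blocks' odd vectors, and
every listed block is legitimate -/
theorem N180_ker_le_span {n u g : ℕ} (M : ℕ) (B : Matrix (Fin u) (Fin n) ℤ) (blocks : List P1LatticeIndexOne180N.Block)
    (hlen : blocks.length = g) (hok : blocks.all (P1LatticeIndexOne180N.Block.ok M) = true)
    (hgen : ∀ s : Fin n → ℤ, B *ᵥ s = 0 → ∃ c : Fin g → ℤ, s = (P1LatticeIndexOne180N.genMat M blocks g n).transpose *ᵥ c) :
    LinearMap.ker (Matrix.mulVecLin B) ≤ N180_L M n := by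
  intro s hs
  rw [LinearMap.mem_ker, Matrix.mulVecLin_apply] at hs
  obtain ⟨c, hc⟩ := hgen s hs
  rw [hc]
  refine mem_span_of_mulVec _ _ (fun j => ?_) c
  have hj : j.val < blocks.length := by
    rw [hlen]
    exact j.isLt
  have hmem : blocks.getD j.val ⟨3, 1, 0, [], 0, 0⟩ ∈ blocks := by
    rw [List.getD_eq_getElem _ _ hj]
    exact List.getElem_mem hj
  exact ⟨(blocks.getD j.val ⟨3, 1, 0, [], 0, 0⟩).ms M, ⟨_, (List.all_eq_true.mp hok) _ hmem, rfl⟩, rfl⟩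

/-- (N180) H_M ≤ L_M at a degree where H_M = 0 -/
theorem N180_ker_le_span_of_zero {n u : ℕ} (M : ℕ) (B : Matrix (Fin u) (Fin n) ℤ)
    (hgen : ∀ s : Fin n → ℤ, B *ᵥ s = 0 → s = 0) : LinearMap.ker (Matrix.mulVecLin B) ≤ N180_L M n := by
  intro s hs
  rw [LinearMap.mem_ker, Matrix.mulVecLin_apply] at hs
  rw [hgen s hs]
  exact Submodule.zero_mem _

end HodgeRepro0.P1.P1LatticeIndexTwoExact
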